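import Mathlib
import Literature.LinearAlgebra.Matrix.BipartiteForestCofactor

/-!
# Principal cofactors of the doubled forest matrix at a ROOT copy: the rooted pointed forest sum

Continuation of `Literature/LinearAlgebra/Matrix/BipartiteForestCofactor.lean` (the bipartite all-minors
matrix-forest formula over `𝔽₂`, [Chaiken1982, §2]): for arc weights `a`, a vertex set `D`, marks `y`,
roots `z`, extra roots `ℓ` and the doubled matrix `N = bigN a D y z ℓ = [[D_y, Pᵀ],[P, D_z]]`,
`det N = setExp (fwt a y z ℓ) D = Σ_π ∏_{B ∈ π} ((Σ_B y) q_z(B) + q_ℓ(B))`, `q_z(B) = Σ_{t∈B} z_t κ_t(B)`.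

The companion file computed the principal cofactor at a MARK copy `inl j` (slope in `y_j`).  Here: the
principal cofactor at a ROOT copy `inr j` is the slope of `det N` in the root weight `z_j`, and on the
forest side the slope of the block weight in `z_j` is `(Σ_B y) κ_j(B)` for the block `B ∋ j` — the block of
`j` becomes a tree converging to the prescribed, unweighted root `j`, keeping its one mark:
* `det_bigN_update_root` — `det N(z + c e_j) = det N(z) + c · adj(N)_{(inr j),(inr j)}`;
* `setExp_fwt_update_root` — the same shift on the forest side;
* `adjugate_bigN_inr_inr` — **`adj(N)_{(inr j)(inr j)} = Σ_{B₀ ⊆ D∖j} (Σ_{{j}∪B₀} y) κ_j({j} ∪ B₀) · setExp(fwt)(D∖j∖B₀)`**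
  (Chaiken's forests with one tree rooted at a prescribed vertex; equivalently the `RootedFormulaHolds`
  clause of the forest-formula file, read through `det (unitize N (inr j)) = adj(N)_{(inr j)(inr j)}`);
* `sum_mul_adjugate_bigN_inr` — weighting by `w_j` and summing: `Σ_j w_j adj(N)_{(inr j)(inr j)} =
  Σ_{B ⊆ D} (Σ_B y) · q_w(B) · setExp(fwt)(D∖B)` (the pointed block is re-rooted by `w`).
With the mark-copy version these evaluate the bordered determinants of Smith 2016, Thm. 2.2 rows 5b and 6
[Smith2016CongruentDensity, §2.2] (borders supported on the `D_z` block of `M₁`, `M₂`).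
-/

namespace Literature.LinearAlgebra.Matrix

open _root_.Matrix Finset Literature.Combinatorics.Enumerative

variable {V : Type*} [Fintype V] [LinearOrder V]

omit [Fintype V] in
/-- **Raising one root weight.** For `j ∈ D`, replacing `z_j` by `z_j + c` replaces row `inr j` of the
doubled matrix by itself plus `c · e_{inr j}` (only the diagonal entry `(inr j, inr j)` moves).
[cite: Chaiken1982, §2 (the variables attached to the vertices of W)] -/
theorem bigN_update_root (a : V → V → ZMod 2) {D : Finset V} {j : V} (hj : j ∈ D)
    (y z ℓ : V → ZMod 2) (c : ZMod 2) :
    bigN a D y (Function.update z j (z j + c)) ℓ =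
      (bigN a D y z ℓ).updateRow (Sum.inr j)
        ((bigN a D y z ℓ) (Sum.inr j) + c • (Pi.single (Sum.inr j) (1 : ZMod 2) : V ⊕ V → ZMod 2)) := by
  ext (i | i) (k | k)
  · rw [updateRow_ne (Sum.inl_ne_inr), bigN_inl_inl, bigN_inl_inl]
  · rw [updateRow_ne (Sum.inl_ne_inr), bigN_inl_inr, bigN_inl_inr]
  · rw [updateRow_apply, bigN_inr_inl]
    by_cases hij : i = j
    · subst hij
      rw [if_pos rfl, Pi.add_apply, Pi.smul_apply, bigN_inr_inl]
      simp
    · have hne : (Sum.inr i : V ⊕ V) ≠ Sum.inr j := fun h => hij (Sum.inr_injective h)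
      rw [if_neg hne, bigN_inr_inl]
  · rw [updateRow_apply, bigN_inr_inr]
    by_cases hij : i = j
    · subst hij
      rw [if_pos rfl, Pi.add_apply, Pi.smul_apply, bigN_inr_inr, if_pos hj, if_pos hj,
        Function.update_self]
      by_cases hik : i = k
      · subst hik; simp
      · have : (Sum.inr k : V ⊕ V) ≠ Sum.inr i := fun h => hik (Sum.inr_injective h).symm
        simp [hik, this]
    · have hne : (Sum.inr i : V ⊕ V) ≠ Sum.inr j := fun h => hij (Sum.inr_injective h)
      rw [if_neg hne, bigN_inr_inr, Function.update_of_ne hij]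

/-- **`det N` is affine in each root weight**, with slope the principal cofactor of the root copy:
`det N(z + c e_j) = det N(z) + c · adj(N)_{(inr j),(inr j)}`.
[cite: Chaiken1982, §2 (all minors matrix tree theorem: the coefficient of a vertex variable is a minor)] -/
theorem det_bigN_update_root (a : V → V → ZMod 2) {D : Finset V} {j : V} (hj : j ∈ D)
    (y z ℓ : V → ZMod 2) (c : ZMod 2) :
    (bigN a D y (Function.update z j (z j + c)) ℓ).det =
      (bigN a D y z ℓ).det + c * (bigN a D y z ℓ).adjugate (Sum.inr j) (Sum.inr j) := by
  rw [bigN_update_root a hj, det_updateRow_add, updateRow_eq_self, det_updateRow_smul,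
    adjugate_apply]

/-- Raising the root weight `z_j` by `c` adds `c · κ_j(B)` to `q_z(B)` when `j ∈ B`, and nothing otherwise.
[cite: ChebotarevAgaev2002, §3 Thm. 2 (in-forests with prescribed roots)] -/
theorem qwt_update (a : V → V → ZMod 2) (z : V → ZMod 2) (j : V) (c : ZMod 2) (B : Finset V) :
    qwt a (Function.update z j (z j + c)) B =
      qwt a z B + if j ∈ B then c * treeDet a B j else 0 := by
  unfold qwt
  by_cases hjB : j ∈ B
  · rw [if_pos hjB, ← add_sum_erase B _ hjB, ← add_sum_erase B (fun t => z t * treeDet a B t) hjB,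
      Function.update_self,
      sum_congr rfl fun t ht => by rw [Function.update_of_ne (ne_of_mem_erase ht)]]
    ring
  · rw [if_neg hjB, add_zero]
    exact sum_congr rfl fun t ht => by rw [Function.update_of_ne (ne_of_mem_of_not_mem ht hjB)]

/-- **The shift on the forest side**: raising `z_j` by `c` adds `c · (Σ_B y) · κ_j(B)` to the weight of
the block `B ∋ j` and leaves all other blocks alone, so
`setExp(fwt(z + c e_j)) D = setExp(fwt z) D + c · Σ_{B₀ ⊆ D∖j} (Σ_{{j}∪B₀} y) κ_j({j} ∪ B₀) · setExp(fwt z)(D∖j∖B₀)`.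
[cite: Chaiken1982, §2] [cite: Stanley1999EC2, Cor. 5.1.6 (exponential formula; elementary finite form)] -/
theorem setExp_fwt_update_root (a : V → V → ZMod 2) {D : Finset V} {j : V} (hj : j ∈ D)
    (y z ℓ : V → ZMod 2) (c : ZMod 2) :
    setExp (fwt a y (Function.update z j (z j + c)) ℓ) D =
      setExp (fwt a y z ℓ) D +
        c * ∑ B₀ ∈ (D.erase j).powerset, (∑ i ∈ insert j B₀, y i) * treeDet a (insert j B₀) j *
          setExp (fwt a y z ℓ) (D.erase j \ B₀) := by
  rw [setExp_peel _ hj, setExp_peel (fwt a y z ℓ) hj, mul_sum, ← sum_add_distrib]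
  refine sum_congr rfl fun B₀ hB₀ => ?_
  rw [mem_powerset] at hB₀
  have hjB₀ : j ∉ B₀ := fun h => notMem_erase j D (hB₀ h)
  -- the blocks avoiding `j` do not see the new root weight
  have hrest : setExp (fwt a y (Function.update z j (z j + c)) ℓ) (D.erase j \ B₀) =
      setExp (fwt a y z ℓ) (D.erase j \ B₀) := by
    refine setExp_congr fun C hC _ => ?_
    have hjC : j ∉ C := fun h => notMem_erase j D ((mem_sdiff.mp (hC h)).1)
    unfold fwt
    rw [qwt_update, if_neg hjC, add_zero]
  -- the block of `j` gains `c · (Σ y) · κ_j`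
  have hblock : fwt a y (Function.update z j (z j + c)) ℓ (insert j B₀) =
      fwt a y z ℓ (insert j B₀) + c * ((∑ i ∈ insert j B₀, y i) * treeDet a (insert j B₀) j) := by
    unfold fwt
    rw [qwt_update, if_pos (mem_insert_self j B₀)]
    ring
  rw [hrest, hblock]
  ring

/-- **The principal cofactor of a root copy is the rooted pointed forest sum**: for `j ∈ D`,
`adj(N)_{(inr j),(inr j)} = Σ_{B₀ ⊆ D∖j} (Σ_{i ∈ {j}∪B₀} y_i) · κ_j({j} ∪ B₀) · setExp(fwt a y z ℓ)(D∖j∖B₀)` —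
forests in which the tree containing `j` converges to `j` itself (an unweighted root) and carries one mark.
[cite: Chaiken1982, §2 (all minors matrix tree theorem, the minor deleting one vertex of W)] -/
theorem adjugate_bigN_inr_inr (a : V → V → ZMod 2) {D : Finset V} {j : V} (hj : j ∈ D)
    (y z ℓ : V → ZMod 2) :
    (bigN a D y z ℓ).adjugate (Sum.inr j) (Sum.inr j) =
      ∑ B₀ ∈ (D.erase j).powerset, (∑ i ∈ insert j B₀, y i) * treeDet a (insert j B₀) j *
        setExp (fwt a y z ℓ) (D.erase j \ B₀) := by
  have h1 := det_bigN_update_root a hj y z ℓ 1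
  rw [det_bigN_eq_setExp, det_bigN_eq_setExp, setExp_fwt_update_root a hj y z ℓ 1, one_mul,
    one_mul] at h1
  exact (add_left_cancel h1).symm

/-- The same cofactor is the determinant of the matrix with the root copy `inr j` unitized (so this is
the `RootedFormulaHolds` clause of the forest-formula file, recovered from the slope in `z_j`).
[cite: Chaiken1982, §2 (forests with a prescribed root)] -/
theorem det_unitize_bigN_inr (a : V → V → ZMod 2) {D : Finset V} {j : V} (hj : j ∈ D)
    (y z ℓ : V → ZMod 2) :
    (unitize (bigN a D y z ℓ) (Sum.inr j)).det =
      ∑ B₀ ∈ (D.erase j).powerset, (∑ i ∈ insert j B₀, y i) * treeDet a (insert j B₀) j *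
        setExp (fwt a y z ℓ) (D.erase j \ B₀) := by
  rw [det_unitize, ← adjugate_apply, adjugate_bigN_inr_inr a hj]

/-- **The rooted pointed forest sum, re-rooted by `w`**:
`Σ_{j ∈ D} w_j · adj(N)_{(inr j),(inr j)} = Σ_{B ⊆ D} (Σ_{i∈B} y_i) · q_w(B) · setExp(fwt)(D ∖ B)`
(`q_w(B) = Σ_{j ∈ B} w_j κ_j(B)`: the distinguished block keeps its mark and takes its root weight from `w`).
[cite: Chaiken1982, §2] [cite: Smith2016CongruentDensity, §2.2 (the bordered determinants with a border in the `D_z` block: rows 5(b), 6, 7(a))] -/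
theorem sum_mul_adjugate_bigN_inr (a : V → V → ZMod 2) (D : Finset V) (y z ℓ w : V → ZMod 2) :
    ∑ j ∈ D, w j * (bigN a D y z ℓ).adjugate (Sum.inr j) (Sum.inr j) =
      ∑ B ∈ D.powerset, (∑ i ∈ B, y i) * qwt a w B * setExp (fwt a y z ℓ) (D \ B) := by
  have hj : ∀ j ∈ D, w j * (bigN a D y z ℓ).adjugate (Sum.inr j) (Sum.inr j) =
      ∑ B₀ ∈ (D.erase j).powerset,
        w j * ((∑ i ∈ insert j B₀, y i) * treeDet a (insert j B₀) j *
          setExp (fwt a y z ℓ) (D \ insert j B₀)) := by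
    intro j hj
    rw [adjugate_bigN_inr_inr a hj, mul_sum]
    exact sum_congr rfl fun B₀ _ => by rw [erase_sdiff_eq_sdiff_insert]
  rw [sum_congr rfl hj, sum_sum_powerset_erase_insert D
    (fun j B => w j * ((∑ i ∈ B, y i) * treeDet a B j * setExp (fwt a y z ℓ) (D \ B)))]
  refine sum_congr rfl fun B _ => ?_
  unfold qwt
  rw [mul_sum, sum_mul]
  exact sum_congr rfl fun j _ => by ring

/-- **Both copies at once** (a border `(w; w)` of the doubled matrix, e.g. the transport of a border in the
`D_z` block of Smith's `M₁`): `Σ_j w_j (adj(N)_{(inl j)(inl j)} + adj(N)_{(inr j)(inr j)}) =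
Σ_{B ⊆ D} ((Σ_B w) q_z(B) + (Σ_B y) q_w(B)) · setExp(fwt)(D∖B)`.
[cite: Chaiken1982, §2] [cite: Smith2016CongruentDensity, §2.2 (row 5(b): the matrix N(A, z, w))] -/
theorem sum_mul_adjugate_bigN_inl_add_inr (a : V → V → ZMod 2) (D : Finset V) (y z ℓ w : V → ZMod 2) :
    ∑ j ∈ D, w j * ((bigN a D y z ℓ).adjugate (Sum.inl j) (Sum.inl j) +
        (bigN a D y z ℓ).adjugate (Sum.inr j) (Sum.inr j)) =
      ∑ B ∈ D.powerset, ((∑ i ∈ B, w i) * qwt a z B + (∑ i ∈ B, y i) * qwt a w B) *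
        setExp (fwt a y z ℓ) (D \ B) := by
  simp only [mul_add, sum_add_distrib, add_mul]
  rw [sum_mul_adjugate_bigN_inl, sum_mul_adjugate_bigN_inr]

end Literature.LinearAlgebra.Matrix
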